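import Mathlib
import Summits.Ventures.HodgeRepro.Tier4.Target
import Summits.Ventures.HodgeRepro.Tier4.Line3.Defs
import Summits.Ventures.HodgeRepro.Tier4.Line3.LocaliserS
import Summits.Ventures.HodgeRepro.Tier4.Line3.Majorant
import Summits.Ventures.HodgeRepro.Tier4.Line3.OffMainOrbit
import Summits.Ventures.HodgeRepro.Tier4.Line3.SylvesterTransfer
import Summits.Ventures.HodgeRepro.Tier4.Line3.DefiniteBound
import Summits.Ventures.HodgeRepro.Tier4.Line3.ClassBoundLemmas
import Summits.Ventures.HodgeRepro.Tier4.Line3.ClassBoundGauss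
import Summits.Ventures.HodgeRepro.Tier4.Line3.InvariantMajorantDef
import Summits.Ventures.HodgeRepro.Tier4.Line3.InvariantClassBound
import Summits.Ventures.HodgeRepro.Tier4.Line3.RayMinor
import Summits.Ventures.HodgeRepro.Tier4.Line3.RayClassBound
import Summits.Ventures.HodgeRepro.Tier4.Line3.CrossMinor

/-!
# Tier4/Line3/FamilyClassBound — the invariant class bound OFF THE CROSS FAMILY (per-slot scalars; the degree-4 rung)

Blind re-derivation cell `pub-hodge-repro`, Tier 4 «PROVE THE STEP» (README §9–§10), LINE L3, lemma L3.5
`term_dominated`; seat t4-L2-p3 (gen 3).  The per-slot successor of `RayClassBound` (one scalar, vacuous on `cfW` by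
crit-1 S13433): the support clause is `SuppSlot` (per-slot scalar copies, x2 S13421 (2)), the excluded set is the
CROSS FAMILY — the orbits of tuples whose degree-4 invariants `crossMinor` all vanish — and the rung is
`exists_crossMinor_size` (CrossMinor).

* `CrossFamily xm : Set X.Orbit := {o | ∃ y, orbitOf (lines y) = o ∧ ∀ i j k l, crossMinor xm y i j k l = 0}` — the
  POLYNOMIAL family: it contains the main orbit, every ray element and every per-slot scalar copy of a ray element
  (`mem_crossFamily_of_slot_copy`: the twist `c(β_i) β_j ρ` cancels), i.e. x2's semantic `ScalarFamily`; it may be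
  larger (block-diagonal `G` with a non-norm ratio of the blocks) — for the MAJORANT that is the right set: off it,
  some cross minor is non-zero BY DEFINITION (`exists_crossMinor_ne_of_not_mem_crossFamily`), no Witt step;
* **`summand_bound_off_family_inv`**: under `SuppSlot` and `GrowthInvOn`, for every depth `N`, every line tuple `w`
  with `orbitOf w ∉ CrossFamily xm` and every `z` in the ball,
  `‖summand (loc N) w z‖ ≤ B q₂^N · invMajorant D e c₁ w z · C₁ e^{−κ (N(𝔭)^N)^{1/(2d)}}` — the decay root is
  `1/(2d)` (the invariant has degree 4 in `x`: a large cross minor forces a large Gram entry only after a square root).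

No printed input is consumed; nothing here asserts anything about the truth of (P); HC_CM is NOT proved by anyone
in this repository.
-/

set_option autoImplicit false

noncomputable section

namespace Summit.Ventures.HodgeRepro.Tier4.Line3

open Summit.Ventures.HodgeRepro.Tier4
open Matrix NumberField
open scoped ComplexConjugate

namespace T4Data

variable (X : T4Data)

/-! ### 1. The cross family -/

/-- **THE CROSS FAMILY** of the main tuple: the orbits of the tuples all of whose degree-4 invariants vanish — the
polynomial closure of x2's scalar family (per-slot scalar copies of ray elements). -/
def CrossFamily (xm : X.Tuple) : Set X.Orbit :=
  {o | ∃ y : X.Tuple, X.orbitOf (X.lines y) = o ∧ ∀ i j k l : Fin 4, X.crossMinor xm y i j k l = 0}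

/-- The cross minors of a per-slot scalar copy of a ray element vanish. -/
theorem crossMinor_slot_copy_eq_zero (xm y : X.Tuple) {ρ : X.E} (hy : ∀ i j, X.gram y i j = ρ * X.gram xm i j)
    (β : Fin 4 → X.E) (i j k l : Fin 4) : X.crossMinor xm (fun j => β j • y j) i j k l = 0 := by
  unfold crossMinor
  rw [X.gram_slot_smul y β i j, X.gram_slot_smul y β k l, X.gram_slot_smul y β i l, X.gram_slot_smul y β k j,
    hy i j, hy k l, hy i l, hy k j]
  ring

/-- Every per-slot scalar copy of a ray element lies in the cross family (x2's `ScalarFamily ⊆ CrossFamily`). -/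
theorem mem_crossFamily_of_slot_copy (xm y : X.Tuple) {ρ : X.E} (hy : ∀ i j, X.gram y i j = ρ * X.gram xm i j)
    (β : Fin 4 → X.E) : X.orbitOf (X.lines fun j => β j • y j) ∈ X.CrossFamily xm :=
  ⟨_, rfl, X.crossMinor_slot_copy_eq_zero xm y hy β⟩

/-- The main orbit lies in the cross family. -/
theorem orbitOf_lines_mem_crossFamily (xm : X.Tuple) : X.orbitOf (X.lines xm) ∈ X.CrossFamily xm :=
  ⟨xm, rfl, fun i j k l => by unfold crossMinor; ring⟩

/-- **OFF THE CROSS FAMILY, SOME CROSS MINOR IS NON-ZERO** (by definition of the family). -/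
theorem exists_crossMinor_ne_of_not_mem_crossFamily (xm x : X.Tuple)
    (hne : X.orbitOf (X.lines x) ∉ X.CrossFamily xm) : ∃ i j k l : Fin 4, X.crossMinor xm x i j k l ≠ 0 := by
  by_contra hall
  apply hne
  refine ⟨x, rfl, fun i j k l => ?_⟩
  by_contra h
  exact hall ⟨i, j, k, l, h⟩

/-- The ball of `SuppSlot` in the spelling of `OffMainOrbit.ballIdeal`. -/
theorem mem_ballIdeal_smul_of_suppSlot (p : IsDedekindDomain.HeightOneSpectrum (RingOfIntegers X.E)) (N : ℕ)
    {L : Submodule (RingOfIntegers X.E) (Fin 3 → X.E)} {v : Fin 3 → X.E}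
    (h : v ∈ (p.asIdeal * X.conjIdeal p.asIdeal) ^ N • L) : v ∈ X.ballIdeal p N • L := by
  rwa [X.conjIdeal_eq_map_cR] at h

/-! ### 2. The class bound off the cross family -/

/-- The decay factor of the family route: `e^{−κ (N(𝔭)^N)^{1/(2d)}}`. -/
def offFamilyDecay (p : IsDedekindDomain.HeightOneSpectrum (RingOfIntegers X.E)) (κ : ℝ) (N : ℕ) : ℝ :=
  Real.exp (-(κ * (((Ideal.absNorm p.asIdeal : ℝ) ^ N) ^ (((2 * Module.finrank ℚ X.E : ℕ) : ℝ)⁻¹))))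

/-- `0 ≤ offFamilyDecay`. -/
theorem offFamilyDecay_nonneg (p : IsDedekindDomain.HeightOneSpectrum (RingOfIntegers X.E)) (κ : ℝ) (N : ℕ) :
    0 ≤ X.offFamilyDecay p κ N := (Real.exp_pos _).le

/-- **THE INVARIANT CLASS BOUND OFF THE CROSS FAMILY.** Under `SuppSlot` and `GrowthInvOn`: there are constants with,
for every depth `N`, every line tuple `w` whose orbit is OFF the cross family and every `z` in the ball,
`‖summand (loc N) w z‖ ≤ B q₂^N · invMajorant D e c₁ w z · (C₁ · offFamilyDecay p κ N)`. -/
theorem summand_bound_off_family_inv (D : X.ThetaData) (p : IsDedekindDomain.HeightOneSpectrum (RingOfIntegers X.E))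
    (xm : X.Tuple) {level : ℕ → X.Level} (loc : ∀ N, X.Tr (level N))
    (hsupp : X.SuppSlot D p xm loc) (hinv : X.GrowthInvOn D loc) :
    ∃ (B q₂ e κ C₁ c₁ : ℝ), 0 < κ ∧ 0 ≤ B ∧ 0 ≤ q₂ ∧ 0 ≤ C₁ ∧ 0 < c₁ ∧
      ∀ (N : ℕ) (w : X.LineTuple) (z : Fin 2 → ℂ), z ∈ ball →
      X.orbitOf w ∉ X.CrossFamily xm →
      ‖X.summand D.Φ D.cf (loc N) w z‖ ≤ B * q₂ ^ N * X.invMajorant D e c₁ w z * (C₁ * X.offFamilyDecay p κ N) := by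
  classical
  obtain ⟨S, hS, hsupp⟩ := hsupp
  obtain ⟨B, q₂, e, c₀, hc₀, hq₂, hgrowth⟩ := hinv
  have hSfg : ∀ L ∈ S, L.FG := fun L hL => (hS L hL).1.1
  obtain ⟨D₀, hD₀, hdev⟩ := X.exists_crossMinor_size p S hSfg xm
  have hdpos : 0 < Module.finrank ℚ X.E := Module.finrank_pos
  -- the constants, kept opaque
  obtain ⟨Dmax, hDmax_pos, hDmax_ge⟩ : ∃ Dmax : ℝ, 0 < Dmax ∧
      ∀ σ : X.E →+* ℂ, ‖σ (algebraMap (RingOfIntegers X.E) X.E D₀)‖ ≤ Dmax := by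
    refine ⟨∑ σ : X.E →+* ℂ, ‖σ (algebraMap (RingOfIntegers X.E) X.E D₀)‖, ?_, fun σ =>
      Finset.single_le_sum (f := fun σ : X.E →+* ℂ => ‖σ (algebraMap (RingOfIntegers X.E) X.E D₀)‖)
        (fun _ _ => norm_nonneg _) (Finset.mem_univ σ)⟩
    obtain ⟨σ₀⟩ : Nonempty (X.E →+* ℂ) := inferInstance
    have hD₀E : algebraMap (RingOfIntegers X.E) X.E D₀ ≠ 0 := by
      intro h
      exact hD₀ ((map_eq_zero_iff _ (RingOfIntegers.coe_injective (K := X.E))).mp h)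
    exact lt_of_lt_of_le (norm_pos_iff.mpr ((map_ne_zero σ₀).mpr hD₀E))
      (Finset.single_le_sum (f := fun σ : X.E →+* ℂ => ‖σ (algebraMap (RingOfIntegers X.E) X.E D₀)‖)
        (fun _ _ => norm_nonneg _) (Finset.mem_univ σ₀))
  obtain ⟨G₀, hG₀_pos, hG₀_ge⟩ : ∃ G₀ : ℝ, 0 < G₀ ∧ ∀ (σ : X.E →+* ℂ) (i j : Fin 4), ‖σ (X.gram xm i j)‖ ≤ G₀ := by
    refine ⟨1 + ∑ σ : X.E →+* ℂ, ∑ i, ∑ j, ‖σ (X.gram xm i j)‖, by positivity, fun σ i j => ?_⟩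
    have h : ‖σ (X.gram xm i j)‖ ≤ ∑ σ : X.E →+* ℂ, ∑ i, ∑ j, ‖σ (X.gram xm i j)‖ :=
      calc ‖σ (X.gram xm i j)‖ ≤ ∑ j, ‖σ (X.gram xm i j)‖ :=
            Finset.single_le_sum (f := fun j => ‖σ (X.gram xm i j)‖) (fun _ _ => norm_nonneg _) (Finset.mem_univ j)
        _ ≤ ∑ i, ∑ j, ‖σ (X.gram xm i j)‖ :=
            Finset.single_le_sum (f := fun i => ∑ j, ‖σ (X.gram xm i j)‖)
              (fun _ _ => Finset.sum_nonneg fun _ _ => norm_nonneg _) (Finset.mem_univ i)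
        _ ≤ ∑ σ : X.E →+* ℂ, ∑ i, ∑ j, ‖σ (X.gram xm i j)‖ :=
            Finset.single_le_sum (f := fun σ : X.E →+* ℂ => ∑ i, ∑ j, ‖σ (X.gram xm i j)‖)
              (fun _ _ => Finset.sum_nonneg fun _ _ => Finset.sum_nonneg fun _ _ => norm_nonneg _) (Finset.mem_univ σ)
    linarith
  obtain ⟨K, hK_pos, hK_ge⟩ : ∃ K : ℝ, 0 < K ∧ ∀ σ : X.E →+* ℂ, ∑ k, ∑ l, ‖σ (X.H k l)‖ ≤ K := by
    refine ⟨∑ σ : X.E →+* ℂ, ∑ k, ∑ l, ‖σ (X.H k l)‖, ?_, fun σ =>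
      Finset.single_le_sum (f := fun σ : X.E →+* ℂ => ∑ k, ∑ l, ‖σ (X.H k l)‖)
        (fun _ _ => Finset.sum_nonneg fun _ _ => Finset.sum_nonneg fun _ _ => norm_nonneg _) (Finset.mem_univ σ)⟩
    obtain ⟨σ₀⟩ : Nonempty (X.E →+* ℂ) := inferInstance
    exact lt_of_lt_of_le (X.sum_norm_emb_H_pos σ₀)
      (Finset.single_le_sum (f := fun σ : X.E →+* ℂ => ∑ k, ∑ l, ‖σ (X.H k l)‖)
        (fun _ _ => Finset.sum_nonneg fun _ _ => Finset.sum_nonneg fun _ _ => norm_nonneg _) (Finset.mem_univ σ₀))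
  obtain ⟨κ₀, hκ₀_pos, hκ₀_le1, hκ₀_le2⟩ : ∃ κ₀ : ℝ, 0 < κ₀ ∧ κ₀ ≤ Real.pi / 4 ∧ κ₀ ≤ c₀ / (2 * K) :=
    ⟨min (Real.pi / 4) (c₀ / (2 * K)), lt_min (by positivity) (by positivity), min_le_left _ _, min_le_right _ _⟩
  -- the square-root constant
  set c₂ : ℝ := Real.sqrt (2 * Dmax * G₀ ^ 2) with hc₂
  have hc₂_pos : 0 < c₂ := Real.sqrt_pos.mpr (by positivity)
  refine ⟨max B 0, q₂, e, κ₀ / c₂, 1, c₀, by positivity, le_max_right _ _, hq₂, zero_le_one, hc₀, ?_⟩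
  intro N w z hz hne
  -- the trivial case: zero coefficient
  by_cases hc : X.coefQ D.cf (loc N) (X.rep w) = 0
  · unfold summand
    rw [hc, zero_mul, norm_zero]
    exact mul_nonneg (mul_nonneg (mul_nonneg (le_max_right _ _) (pow_nonneg hq₂ _))
      (X.invMajorant_nonneg _ _ _ _ _)) (mul_nonneg zero_le_one (X.offFamilyDecay_nonneg p _ N))
  obtain ⟨lam, x, L, hL, hlam, hx⟩ := hsupp N w hc
  have hl : ∀ j, lam j • xm j ∈ L := fun j => (hlam j).2.1
  have hball' : ∀ j, x j - lam j • xm j ∈ X.ballIdeal p N • L := fun j =>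
    X.mem_ballIdeal_smul_of_suppSlot p N (hlam j).2.2
  have hne' : X.orbitOf (X.lines x) ∉ X.CrossFamily xm := by rwa [hx]
  obtain ⟨i, j, k, l, hM⟩ := X.exists_crossMinor_ne_of_not_mem_crossFamily xm x hne'
  obtain ⟨σ, hσ⟩ := hdev N lam x L hL hl hball' i j k l hM
  -- the `d`-th root: `RN ≤ ‖σ D₀‖ ‖σ α‖`
  obtain ⟨RN, hRN⟩ : ∃ RN : ℝ, RN = ((Ideal.absNorm p.asIdeal : ℝ) ^ N) ^ ((Module.finrank ℚ X.E : ℝ)⁻¹) := ⟨_, rfl⟩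
  have hRN0 : 0 ≤ RN := by rw [hRN]; positivity
  obtain ⟨α, hα⟩ : ∃ α : X.E, α = X.crossMinor xm x i j k l := ⟨_, rfl⟩
  have hroot : RN ≤ ‖σ (algebraMap (RingOfIntegers X.E) X.E D₀)‖ * ‖σ α‖ := by
    have h1 : ((Ideal.absNorm p.asIdeal : ℝ) ^ N) ^ ((Module.finrank ℚ X.E : ℝ)⁻¹) ≤
        ((‖σ (algebraMap (RingOfIntegers X.E) X.E D₀)‖ * ‖σ α‖) ^ Module.finrank ℚ X.E) ^
          ((Module.finrank ℚ X.E : ℝ)⁻¹) := by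
      apply Real.rpow_le_rpow (by positivity) _ (by positivity)
      rw [mul_pow, hα]
      exact hσ
    rw [Real.pow_rpow_inv_natCast (by positivity) hdpos.ne'] at h1
    rw [hRN]
    exact h1
  have hα_ge : RN / Dmax ≤ ‖σ α‖ := by
    rw [div_le_iff₀ hDmax_pos]
    calc RN ≤ ‖σ (algebraMap (RingOfIntegers X.E) X.E D₀)‖ * ‖σ α‖ := hroot
      _ ≤ Dmax * ‖σ α‖ := mul_le_mul_of_nonneg_right (hDmax_ge σ) (norm_nonneg _)
      _ = ‖σ α‖ * Dmax := mul_comm _ _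
  -- a large cross minor forces a large Gram entry of the ball representative among the four involved
  obtain ⟨R', hR'⟩ : ∃ R' : ℝ, R' = Real.sqrt RN / c₂ := ⟨_, rfl⟩
  have hR'0 : 0 ≤ R' := by rw [hR']; positivity
  have hminor : ‖σ α‖ ≤ G₀ ^ 2 * (‖σ (X.gram x i j)‖ * ‖σ (X.gram x k l)‖ +
      ‖σ (X.gram x i l)‖ * ‖σ (X.gram x k j)‖) := by
    rw [hα]
    exact X.norm_crossMinor_le xm x σ hG₀_pos.le (hG₀_ge σ) i j k l
  have hR'sq : 2 * G₀ ^ 2 * R' ^ 2 = RN / Dmax := by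
    rw [hR', div_pow, Real.sq_sqrt hRN0, hc₂, Real.sq_sqrt (by positivity)]
    field_simp
  have hentry : ∃ i' j' : Fin 4, R' ≤ ‖σ (X.gram x i' j')‖ := by
    by_contra hcon
    have hlt : ∀ i' j' : Fin 4, ‖σ (X.gram x i' j')‖ < R' := by
      intro i' j'
      by_contra h
      exact hcon ⟨i', j', not_lt.mp h⟩
    have h1 : ‖σ (X.gram x i j)‖ * ‖σ (X.gram x k l)‖ < R' * R' :=
      mul_lt_mul'' (hlt i j) (hlt k l) (norm_nonneg _) (norm_nonneg _)
    have h2 : ‖σ (X.gram x i l)‖ * ‖σ (X.gram x k j)‖ < R' * R' :=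
      mul_lt_mul'' (hlt i l) (hlt k j) (norm_nonneg _) (norm_nonneg _)
    have h3 : ‖σ α‖ < G₀ ^ 2 * (2 * (R' * R')) := by
      calc ‖σ α‖ ≤ G₀ ^ 2 * (‖σ (X.gram x i j)‖ * ‖σ (X.gram x k l)‖ +
            ‖σ (X.gram x i l)‖ * ‖σ (X.gram x k j)‖) := hminor
        _ < G₀ ^ 2 * (2 * (R' * R')) := by
            apply mul_lt_mul_of_pos_left _ (by positivity)
            linarith
    have h4 : G₀ ^ 2 * (2 * (R' * R')) = RN / Dmax := by rw [← hR'sq]; ring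
    linarith
  obtain ⟨i', j', hgram_ge⟩ := hentry
  -- the chosen representative is a unit multiple of the ball representative: same Gram sizes
  choose t ht hrep using fun k => X.rep_eq_smul_of_lines_eq hx k
  have hgram_rep : R' ≤ ‖σ (X.gram (X.rep w) i' j')‖ := by
    show R' ≤ ‖σ (hform X.c X.H (X.rep w i') (X.rep w j'))‖
    rw [hrep i', hrep j', X.norm_emb_hform_smul_eq σ (ht i') (ht j')]
    exact hgram_ge
  -- the decay
  have hdecay := X.decay_quarter_of_gram_entry hc₀ hK_ge hκ₀_pos hκ₀_le1 hκ₀_le2 (X.rep w) hz σ i' j' hgram_rep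
  -- the kernel is the kernel majorant times the quarter Gaussians
  obtain ⟨Hf, hHf⟩ : ∃ Hf : ℝ, Hf = ∏ k, Real.exp (-(Real.pi / 4) * maj (X.ballCoord (X.rep w k)) z) := ⟨_, rfl⟩
  have hHf0 : 0 ≤ Hf := by rw [hHf]; exact Finset.prod_nonneg fun k _ => (Real.exp_pos _).le
  have hker : ‖X.kernel D.Φ (X.rep w) z‖ = X.kerMaj D (X.rep w) z * Hf := by
    unfold kerMaj
    rw [hHf, mul_assoc, ← Finset.prod_mul_distrib]
    have h1 : ∀ k, Real.exp (Real.pi / 4 * maj (X.ballCoord (X.rep w k)) z) *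
        Real.exp (-(Real.pi / 4) * maj (X.ballCoord (X.rep w k)) z) = 1 := fun k => by
      rw [← Real.exp_add, show Real.pi / 4 * maj (X.ballCoord (X.rep w k)) z +
        -(Real.pi / 4) * maj (X.ballCoord (X.rep w k)) z = 0 by ring, Real.exp_zero]
    simp only [h1, Finset.prod_const_one, mul_one]
  rw [← hHf] at hdecay
  -- the bound for every `g ∈ Γ⁴`
  have hkm0 : 0 ≤ X.kerMaj D (X.rep w) z := X.kerMaj_nonneg D _ z
  have hg : ∀ g : Fin 4 → X.Γ, ‖X.summand D.Φ D.cf (loc N) w z‖ ≤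
      (max B 0 * q₂ ^ N * X.kerMaj D (X.rep w) z * Real.exp (-(κ₀ * R'))) * X.quadMaj e c₀ (X.rep w) g := by
    intro g
    unfold summand
    rw [norm_mul, hker]
    have hcoef' : ‖X.coefQ D.cf (loc N) (X.rep w)‖ ≤
        max B 0 * q₂ ^ N * X.quadMaj e c₀ (X.rep w) g * ∏ k, X.gaussDefAt c₀ (X.rep w k) :=
      (hgrowth N w g).trans (mul_le_mul_of_nonneg_right (mul_le_mul_of_nonneg_right
        (mul_le_mul_of_nonneg_right (le_max_left _ _) (pow_nonneg hq₂ _)) (X.quadMaj_nonneg _ _ _ _))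
        (Finset.prod_nonneg fun _ _ => X.gaussDefAt_nonneg _ _))
    calc ‖X.coefQ D.cf (loc N) (X.rep w)‖ * (X.kerMaj D (X.rep w) z * Hf)
        ≤ (max B 0 * q₂ ^ N * X.quadMaj e c₀ (X.rep w) g * ∏ k, X.gaussDefAt c₀ (X.rep w k)) *
            (X.kerMaj D (X.rep w) z * Hf) :=
          mul_le_mul_of_nonneg_right hcoef' (mul_nonneg hkm0 hHf0)
      _ = (max B 0 * q₂ ^ N * X.kerMaj D (X.rep w) z * X.quadMaj e c₀ (X.rep w) g) *
            ((∏ k, X.gaussDefAt c₀ (X.rep w k)) * Hf) := by ring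
      _ ≤ (max B 0 * q₂ ^ N * X.kerMaj D (X.rep w) z * X.quadMaj e c₀ (X.rep w) g) * Real.exp (-(κ₀ * R')) :=
          mul_le_mul_of_nonneg_left hdecay (mul_nonneg (mul_nonneg (mul_nonneg (le_max_right _ _)
            (pow_nonneg hq₂ _)) hkm0) (X.quadMaj_nonneg _ _ _ _))
      _ = (max B 0 * q₂ ^ N * X.kerMaj D (X.rep w) z * Real.exp (-(κ₀ * R'))) * X.quadMaj e c₀ (X.rep w) g := by
          ring
  -- pass to the infimum over `Γ⁴`
  have hinf : ‖X.summand D.Φ D.cf (loc N) w z‖ ≤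
      (max B 0 * q₂ ^ N * X.kerMaj D (X.rep w) z * Real.exp (-(κ₀ * R'))) * X.gammaInf e c₀ (X.rep w) := by
    unfold gammaInf
    rw [Real.mul_iInf_of_nonneg (mul_nonneg (mul_nonneg (mul_nonneg (le_max_right _ _) (pow_nonneg hq₂ _)) hkm0)
      (Real.exp_pos _).le)]
    haveI := X.nonempty_gammaFour
    exact le_ciInf hg
  -- `√RN = (N(𝔭)^N)^{1/(2d)}`
  have hsqrt : Real.sqrt RN = ((Ideal.absNorm p.asIdeal : ℝ) ^ N) ^ (((2 * Module.finrank ℚ X.E : ℕ) : ℝ)⁻¹) := by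
    rw [hRN, Real.sqrt_eq_rpow, ← Real.rpow_mul (by positivity)]
    congr 1
    push_cast
    field_simp
  have hexp : Real.exp (-(κ₀ * R')) = 1 * X.offFamilyDecay p (κ₀ / c₂) N := by
    unfold offFamilyDecay
    rw [one_mul, hR', ← hsqrt]
    congr 1
    field_simp
  calc ‖X.summand D.Φ D.cf (loc N) w z‖
      ≤ (max B 0 * q₂ ^ N * X.kerMaj D (X.rep w) z * Real.exp (-(κ₀ * R'))) * X.gammaInf e c₀ (X.rep w) := hinf
    _ = max B 0 * q₂ ^ N * X.invMajorant D e c₀ w z * (1 * X.offFamilyDecay p (κ₀ / c₂) N) := by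
        unfold invMajorant
        rw [hexp]
        ring

end T4Data

end Summit.Ventures.HodgeRepro.Tier4.Line3

end
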